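import Mathlib
import Summits.MatrixMultiplication.Statement
import Summits.MatrixMultiplication.MatrixMultiplication.Theorems.GraphEquationsCubicMaskedSquare

/-!
# `AQRₙ` and `C3ₙ` REFUTED for every `n ≥ 2`; unmasking by one generator (`GraphEquations`, M51b)

Decomp-mm node «GraphEquations» (lens 5, g41); attacked leaf `MultiplicityReduction`
(stmt-MatrixMultiplication-27806).  Target VERBATIM: `_root_.MatrixMultiplication`.  Route-neutral.

From the masked square cubic system of M51a (`cubicMaskSystem r s j₀`: correct, nowhere reduced,
`m = n²`, one quadratic test) this file draws the consequences BY NAME: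
* `not_affineQuadricRigidity (2 ≤ n)`, `affineQuadricRigidity_iff_le_one : AQRₙ ↔ n ≤ 1`,
  `not_forall_affineQuadricRigidity_ge_three` — the hypothesis `∀ n ≥ 3, AQRₙ` of the g40 bridge
  `omega_le_of_affineQuadricRigidity'` (M45) is UNSATISFIABLE;
* `not_cubicReduction (2 ≤ n)` (through M44 `affineQuadricRigidity_of_cubicReduction`),
  `cubicReduction_iff_le_one : C3ₙ ↔ n ≤ 1`, `not_cubicReduction_all`,
  `exists_correct_isCubic_not_genericallyReduced`, `masking_threshold` — MASKING STARTS IN DEGREE `3`,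
  not `4` (degree `2`: `genericallyReduced_of_isQuadratic`; degree `4`: `GraphEquationsMaskingWitness`);
* `unmaskedSystem_correct`, `unmaskedSystem_reducedAt`, `exists_correct_reduced_extension` — appending
  the ONE generator `f_⋆` (cost `n` products) to the masked system gives a correct cubic system REDUCED
  AT EVERY graph point: the honest reading of rung `3` is UNMASKING COST (`GraphEquationsUnmasking`),
  not rigidity; the dial statement `ω₃ = ω` stays NEC and open, the cut `closes (hV) (hM)` unchanged.
No `sorry`.  Sources: [BurgisserClausenShokrollahi1997, Problem 16.3, (15.1)]; [Strassen1973].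
-/

-- dupNamespace: forced by the nested Summit.MatrixMultiplication.MatrixMultiplication layout (D-0017)
set_option linter.dupNamespace false

noncomputable section

namespace Summit.MatrixMultiplication.MatrixMultiplication.Theorems.GraphEquations

open Matrix

variable {n : ℕ}

/-! ## Unmasking by ONE generator: `cubicMaskSystem ⊕ f_⋆` is reduced at every graph point -/

/-- The masked system with the single generator `f_⋆ = c_⋆ − Σ_k a_{sk} b_{kj₀}` appended (cost `n`
products): `n² + 1` cubic tests. -/
def unmaskedSystem (r s j₀ : Fin n) : AffSystem n :=
  ⟨n * n + 1, fun j => if h : (j : ℕ) < n * n then cubicMaskTest r s j₀ ((flat n).symm ⟨j, h⟩)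
    else coordTest (s, j₀)⟩

/-- The appended system contains every test of the masked system. -/
theorem unmaskedSystem_test_castSucc (r s j₀ : Fin n) (j : Fin (n * n)) :
    (unmaskedSystem r s j₀).test (Fin.castSucc j) = (cubicMaskSystem r s j₀).test j := by
  simp [unmaskedSystem, cubicMaskSystem]

/-- Its last test is the generator `f_⋆`. -/
theorem unmaskedSystem_test_last (r s j₀ : Fin n) :
    (unmaskedSystem r s j₀).test (Fin.last (n * n)) = coordTest (s, j₀) := by
  simp [unmaskedSystem]

/-- The appended system is CORRECT (it contains a correct system). -/
theorem unmaskedSystem_correct {r s : Fin n} (hrs : r ≠ s) (j₀ : Fin n) :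
    (unmaskedSystem r s j₀).Correct := by
  intro A B C h
  refine cubicMaskSystem_correct hrs j₀ A B C fun j => ?_
  rw [← unmaskedSystem_test_castSucc]
  exact h _

/-- **Unmasked**: the appended system is REDUCED AT EVERY graph point — one generator of cost `n`
removes the mask (the slot rows give `δ_{(r,k)} = a_{sk} δ_⋆`, the coordinate rows `δ_q = 0`, the new
row `δ_⋆ = 0`). -/
theorem unmaskedSystem_reducedAt {r s : Fin n} (hrs : r ≠ s) (j₀ : Fin n) (A B : Vec n) :
    (unmaskedSystem r s j₀).ReducedAt A B := by
  intro δ hδ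
  have hq : ∀ q : Fin n × Fin n, (cubicMaskTest r s j₀ q).jac A B ⬝ᵥ δ = 0 := fun q => by
    have := hδ (Fin.castSucc (flat n q))
    rwa [unmaskedSystem_test_castSucc, cubicMaskSystem_test] at this
  have hstar : δ (s, j₀) = 0 := by
    have := hδ (Fin.last (n * n))
    rw [unmaskedSystem_test_last] at this
    simpa [coordTest, AffTest.jac, AffTest.coef] using this
  funext q
  by_cases h1 : q.1 = r
  · have := hq q
    rw [cubicMaskTest, if_pos h1, slotTest_jac, sub_dotProduct, smul_dotProduct, single_dotProduct,
      single_dotProduct, one_mul, one_mul, hstar, smul_eq_mul, mul_zero, sub_zero] at this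
    obtain ⟨q1, q2⟩ := q
    simp only at h1
    subst h1
    exact this
  · by_cases h2 : q = (s, j₀)
    · rw [h2, hstar]; rfl
    · have := hq q
      rw [cubicMaskTest, if_neg h1, if_neg h2] at this
      simpa [coordTest, AffTest.jac, AffTest.coef] using this

/-- Unmasking cost of the masked square system, at the affine level: ONE more cubic test (a generator,
`n` products) yields a correct system reduced at every graph point. -/
theorem exists_correct_reduced_extension {r s : Fin n} (hrs : r ≠ s) (j₀ : Fin n) :
    ∃ S' : AffSystem n, S'.m = n * n + 1 ∧ S'.Correct ∧ ∀ A B, S'.ReducedAt A B :=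
  ⟨unmaskedSystem r s j₀, rfl, unmaskedSystem_correct hrs j₀, unmaskedSystem_reducedAt hrs j₀⟩

/-! ## The refutations -/

/-- **A correct, nowhere-reduced, square affine system exists for every `n ≥ 2`.** -/
theorem exists_correct_nowhereReduced_square (hn : 2 ≤ n) :
    ∃ S : AffSystem n, S.Correct ∧ S.NowhereReduced ∧ S.m = n * n :=
  have hrs : (⟨0, by omega⟩ : Fin n) ≠ ⟨1, by omega⟩ := by simp
  ⟨cubicMaskSystem ⟨0, by omega⟩ ⟨1, by omega⟩ ⟨0, by omega⟩, cubicMaskSystem_correct hrs _,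
    cubicMaskSystem_nowhereReduced hrs _, rfl⟩

/-- **`AQRₙ` is FALSE for every `n ≥ 2`.** -/
theorem not_affineQuadricRigidity (hn : 2 ≤ n) : ¬ AffSystem.AffineQuadricRigidity n := by
  rw [AffSystem.affineQuadricRigidity_iff]
  obtain ⟨S, hC, hN, -⟩ := exists_correct_nowhereReduced_square hn
  exact fun h => h S hC hN

/-- `AQRₙ` holds exactly in the base range `n ≤ 1`. -/
theorem affineQuadricRigidity_iff_le_one : AffSystem.AffineQuadricRigidity n ↔ n ≤ 1 := by
  refine ⟨fun h => ?_, fun h => ?_⟩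
  · by_contra hlt
    exact not_affineQuadricRigidity (by omega) h
  · interval_cases n
    · exact AffSystem.affineQuadricRigidity_zero
    · exact AffSystem.affineQuadricRigidity_one

/-- The hypothesis of the g40 bridge `omega_le_of_affineQuadricRigidity'` is unsatisfiable. -/
theorem not_forall_affineQuadricRigidity_ge_three :
    ¬ ∀ m, 3 ≤ m → AffSystem.AffineQuadricRigidity m :=
  fun h => not_affineQuadricRigidity (n := 3) (by norm_num) (h 3 le_rfl)

/-- **Conjecture C3ₙ is FALSE for every `n ≥ 2`**: masking starts in degree `3`. -/
theorem not_cubicReduction (hn : 2 ≤ n) : ¬ CubicReduction n :=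
  fun h => not_affineQuadricRigidity hn (affineQuadricRigidity_of_cubicReduction h)

/-- `C3ₙ` holds exactly in the base range `n ≤ 1`. -/
theorem cubicReduction_iff_le_one : CubicReduction n ↔ n ≤ 1 :=
  ⟨fun h => by by_contra hlt; exact not_cubicReduction (by omega) h, cubicReduction_of_le_one⟩

/-- `C3` fails as a family. -/
theorem not_cubicReduction_all : ¬ ∀ m, CubicReduction m :=
  fun h => not_cubicReduction (n := 2) le_rfl (h 2)

/-- Unfolded: for every `n ≥ 2` there is a CORRECT CUBIC equation system for `W_n` that is NOT
generically reduced (masked at every graph point). -/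
theorem exists_correct_isCubic_not_genericallyReduced (hn : 2 ≤ n) :
    ∃ E : EqSystem n, E.Correct ∧ E.IsCubic ∧ ¬ E.GenericallyReduced := by
  have h := not_cubicReduction hn
  unfold CubicReduction at h
  push Not at h
  exact h

/-- The degree threshold of masking is exactly `3`: correct QUADRATIC systems are generically reduced
(rung `2`, proved), correct CUBIC systems need not be (`n ≥ 2`). -/
theorem masking_threshold (hn : 2 ≤ n) :
    (∀ E : EqSystem n, E.Correct → E.IsQuadratic → E.GenericallyReduced) ∧ ¬ CubicReduction n :=
  ⟨fun _ hE h2 => EqSystem.genericallyReduced_of_isQuadratic hE h2, not_cubicReduction hn⟩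

end Summit.MatrixMultiplication.MatrixMultiplication.Theorems.GraphEquations

end
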